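import Literature.AnabelianGeometry.AbsoluteAnabelian.AbsTopII.DehnTwistLoopSections
import Literature.AnabelianGeometry.AbsoluteAnabelian.AbsTopII.DehnTwistLoopProp13v
import HarnessLib

/-!
# [AbsTopII] Prop 1.3 (x) HOLDS at the nodal Dehn-twist datum — and its NODE clause fires

S. Mochizuki, *Topics in Absolute Anabelian Geometry II* [AbsTopII] (bib `MochizukiAbsTopII2013`; locators =
PDF pages of the kurims manuscript `paper:url-585b8d0ad0d9`), §1, Def 1.2 (ii) p. 10, Prop 1.3 (x) p. 12:

> "(x) [...] Then if `τ_I` is non-verticial and non-edge-like, then the image of `τ_S` is the unique cusp `e_τ`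
> of `X` such that [for an appropriate choice of conjugate of `D_{e_τ}`] `τ_I(I) ⊆ D_{e_τ}`.  Now suppose that
> the image of `τ_S` is not a cusp.  Then `τ_I` satisfies the condition `τ_I(I) = I_{v_τ}` for some vertex `v_τ`
> of `𝔾` [and an appropriate choice of conjugate of `I_{v_τ}`] if and only if the image of `τ_S` is a non-nodal
> point of the irreducible component of `X` corresponding to `v_τ`; `τ_I` is non-verticial and satisfies the
> condition `τ_I(I) ⊆ I_{e_τ}` for some node `e_τ` of `𝔾` [and an appropriate choice of conjugate of `I_{e_τ}`]
> if and only if the image of `τ_S` is the node of `X` corresponding to `e_τ`."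

PROOF-ONLY companion (abc-iut-L4-t6 lineage, row «P13x″-NODAL-LOGPOINTS») of `DehnTwistLoopSections.lean`:
the statement of record `DPSCIndexData.Prop_1_3_x''` (`InertiaGroupsLogPoints.lean`, p436561 — Prop 1.3 (x)
for a FAMILY of labelled sections supplied by the model) HOLDS for the family `DehnTwist.logPoints i hi` of the
nodal DPSC datum `DehnTwist.dpsc i hi` (degenerating once-punctured genus-one curve; `Π_I = F̂₂ ⋊_{shear^i} Ẑ`,
`I_v = 1 ⋊ Ẑ`, `I_e = b^Ẑ ⋊ Ẑ`, `D_c = c^Ẑ ⋊ Ẑ`), with NO hypothesis — and, for `i ≥ 2`, NON-IDLY IN THE NODE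
CLAUSE: the slope sections `T_m = {(b^{k^m}, k)}`, `0 < m < i`, are NON-VERTICIAL (contained in no conjugate of
`I_v`) and lie in `I_e`, so "`τ_I` non-verticial and `τ_I(I) ⊆ I_{e_τ}`" is TRUE exactly at the members labelled
"node" — a clause every smooth-curve model leaves idle (no node).

The invariant (why `T_m` is non-verticial): layer L2's Heisenberg level map `ĥ_N : F̂₂ → Heis(ℤ/N)`
(`SettingModel.hHat`) at `N = i` is INVARIANT under the Dehn twist `shear_{k^i}` (`hHat_shear_of_level_eq_one`
with `ZHatLevel.level_pow_self`: `b^{k^i}` has level-`i` value `1`); a conjugate of `I_v` is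
`{(h·shear_{k^i}(h)⁻¹, k)}` (`mem_conj_smul_range_inr_iff`, over abc-iut-f-069's `conj_inr_eq`), whose `F̂₂`-parts die under `ĥ_i`, whereas
`ĥ_i(b^{ι(1)^m}) = (0, m mod i, 0)`.
Inputs BY NAME: gen-7 S1–S3 (`shearPow_*`, `Iv_dpsc_eq_range_inr_holds`, `mem_centralizer_node_inf_top_iff`,
`bPow_mem_centralizer_nodeGp`, `range_inr_le_centralizer`, `left/right_inl_mul_inr`), abc-iut-f-069
(`normalizer_map_inl_cuspGp_eq`, `cuspGp_eq_cAxis`, `shearPow_mem_cuspGp_of_mem`, `mem_map_inl_sup_range_inr_iff`),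
layer L2 (`hHat`, `hHat_bPow`, `hHat_cPow`, `hHat_shear_of_level_eq_one`, `modN_iotaZ`, `iotaZ_one_eq`,
`ZHatLevel.level_eta`, `ZHatLevel.level_pow_self`).
HONEST FRAMING: constructed ≠ geometric (the family is the model's label for the log points of the degenerate
curve); an instance at a constructed datum, not the printed theorem for stable log curves; nothing here bears on
[IUTchIII] Cor 3.12.
-/

noncomputable section

open scoped Pointwise

namespace Literature.AnabelianGeometry.AbsoluteAnabelian.AbsTopII.DehnTwist

open Literature.AnabelianGeometry.EtaleTheta.SettingModel
open _root_.Topology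

variable (i : ℕ)

/-! ### The Heisenberg level map `ĥ_i` is invariant under the Dehn twist of speed `i` -/

/-- **`ĥ_i ∘ shear_{k^i} = ĥ_i`**: the twist moves `a ↦ a·b^{k^i}` and `b^{k^i}` has level-`i` value `1`.
[cite: MochizukiAbsTopII2013, Prop 1.3 (x) p.12] -/
theorem hHat_shearPow (hi : 0 < i) (k : ZH) (x : F₂hatT) : hHat ⟨i, hi⟩ (shearPow i k x) = hHat ⟨i, hi⟩ x := by
  rw [shearPow_apply]
  exact hHat_shear_of_level_eq_one ⟨i, hi⟩ (EtaleTheta.ZHatLevel.level_pow_self ⟨i, hi⟩ k) x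

/-- `ι(1)^m = ι(m)` in `Ẑ`. [cite: MochizukiAbsTopII2013, Ex 1.1 (iii) p.9] -/
theorem iotaZ_one_pow (m : ℕ) :
    iotaZ (Multiplicative.ofAdd 1) ^ m = iotaZ (Multiplicative.ofAdd (m : ℤ)) := by
  rw [← map_pow, ← ofAdd_nsmul, nsmul_one]

/-- `level_N (ι(1)^m) = m mod N`. [cite: MochizukiAbsTopII2013, Ex 1.1 (iii) p.9] -/
theorem toAdd_level_iotaZ_one_pow (N : ℕ+) (m : ℕ) :
    Multiplicative.toAdd (EtaleTheta.ZHatLevel.level N (iotaZ (Multiplicative.ofAdd 1) ^ m)) = (m : ZMod N) := by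
  rw [iotaZ_one_pow]
  change Multiplicative.toAdd (EtaleTheta.ZHatLevel.level N (EtaleTheta.ZHatLevel.eta m)) = _
  rw [EtaleTheta.ZHatLevel.level_eta, toAdd_ofAdd, Int.cast_natCast]

/-- `mod_N (ι(1)^n) = n mod N`. [cite: MochizukiAbsTopII2013, Ex 1.1 (iii) p.9] -/
theorem toAdd_modN_iotaZ_one_pow (N : ℕ+) (n : ℕ) :
    Multiplicative.toAdd (modN N (iotaZ (Multiplicative.ofAdd 1) ^ n)) = (n : ZMod N) := by
  rw [iotaZ_one_pow, modN_iotaZ, toAdd_ofAdd, toAdd_ofAdd, Int.cast_natCast]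

/-- **`ĥ_N (b^{ι(1)^m}) = (0, m mod N, 0)`**. [cite: MochizukiAbsTopII2013, Prop 1.3 (x) p.12] -/
theorem hHat_bPow_iotaZ_one_pow (N : ℕ+) (m : ℕ) :
    hHat N (bPow (iotaZ (Multiplicative.ofAdd 1) ^ m)) = ⟨0, (m : ZMod N), 0⟩ := by
  rw [hHat_bPow, toAdd_level_iotaZ_one_pow]

/-- **`ĥ_N (c^{ι(1)^n}) = (0, 0, n mod N)`**. [cite: MochizukiAbsTopII2013, Prop 1.3 (x) p.12] -/
theorem hHat_cPow_iotaZ_one_pow (N : ℕ+) (n : ℕ) :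
    hHat N (cPow (iotaZ (Multiplicative.ofAdd 1) ^ n)) = ⟨0, 0, (n : ZMod N)⟩ := by
  rw [hHat_cPow, toAdd_modN_iotaZ_one_pow]

/-! ### Conjugates of `I_v = 1 ⋊ Ẑ` in `Π_I` -/

/-- **The conjugates of `I_v`**: `x ∈ γ·(1 ⋊ Ẑ)·γ⁻¹ ⇔ x.left = γ.left · shear_{x.right^i}(γ.left)⁻¹` — a
conjugate of the verticial section is the graph of the twist-coboundary of `γ.left` (abc-iut-f-069's
`conj_inr_eq`, `DehnTwistLoopProp13v`). [cite: MochizukiAbsTopII2013, Prop 1.3 (x) p.12] -/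
theorem mem_conj_smul_range_inr_iff (γ x : Ext i) :
    x ∈ MulAut.conj γ • (SemidirectProduct.inr : ZH →* Ext i).range ↔
      x.left = γ.left * (shearPow i x.right γ.left)⁻¹ := by
  rw [Subgroup.mem_smul_pointwise_iff_exists]
  constructor
  · rintro ⟨_, ⟨k, rfl⟩, rfl⟩
    rw [MulAut.smul_def, MulAut.conj_apply, conj_inr_eq, left_inl_mul_inr, right_inl_mul_inr]
  · intro hx
    refine ⟨SemidirectProduct.inr x.right, ⟨x.right, rfl⟩, ?_⟩
    rw [MulAut.smul_def, MulAut.conj_apply, conj_inr_eq, ← hx, SemidirectProduct.inl_left_mul_inr_right]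

/-- **Verticial sections are invisible to `ĥ_i`**: every element of a conjugate of `I_v` has `F̂₂`-part in
`Ker ĥ_i` (twist-invariance of `ĥ_i`). [cite: MochizukiAbsTopII2013, Prop 1.3 (x) p.12] -/
theorem hHat_left_eq_one_of_mem_conj_smul_range_inr (hi : 0 < i) {γ x : Ext i}
    (hx : x ∈ MulAut.conj γ • (SemidirectProduct.inr : ZH →* Ext i).range) : hHat ⟨i, hi⟩ x.left = 1 := by
  rw [mem_conj_smul_range_inr_iff] at hx
  rw [hx, map_mul, map_inv, hHat_shearPow i hi, mul_inv_cancel]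

/-- A conjugate by `δ ∈ Π_I` of a subgroup containing `I_v = 1 ⋊ Ẑ` is its conjugate by `(δ.left, 1) ∈ Π_𝔾`
(`δ = (δ.left,1)·(1,δ.right)` and `(1,δ.right)` lies in the subgroup) — so the "appropriate conjugates" of
`I_v`, `I_e`, `D_c` met below are `Π_𝔾`-conjugates, as Def 1.2 (ii) p. 10 wants.
[cite: MochizukiAbsTopII2013, Def 1.2 (ii) p.10] -/
theorem conj_smul_eq_conj_inl_left_smul {H : Subgroup (Ext i)}
    (hH : (SemidirectProduct.inr : ZH →* Ext i).range ≤ H) (δ : Ext i) :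
    MulAut.conj δ • H = MulAut.conj (SemidirectProduct.inl δ.left : Ext i) • H := by
  conv_lhs => rw [← SemidirectProduct.inl_left_mul_inr_right δ, map_mul, mul_smul,
    Subgroup.conj_smul_eq_self_of_mem (hH ⟨δ.right, rfl⟩)]

/-! ### The slope sections `T_m`, `0 < m < i`, are NON-VERTICIAL; `T_m ≤ I_e`, `U_n ≤ D_c` -/

/-- **`T_m ⊄ γ I_v γ⁻¹` for `0 < m < i` and every `γ ∈ Π_I`**: the element `(b^{ι(1)^m}, ι(1)) ∈ T_m` has
`ĥ_i`-value `(0, m mod i, 0) ≠ 1`, but conjugates of `I_v` are `ĥ_i`-invisible.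
[cite: MochizukiAbsTopII2013, Prop 1.3 (x) p.12] -/
theorem not_range_slopeSection_le_conj_smul_range_inr (hi : 0 < i) {m : ℕ} (hm : 0 < m) (hmi : m < i)
    (γ : Ext i) :
    ¬ (slopeSection i m).range ≤ MulAut.conj γ • (SemidirectProduct.inr : ZH →* Ext i).range := by
  intro hle
  have hmem : slopeSection i m (iotaZ (Multiplicative.ofAdd 1)) ∈
      MulAut.conj γ • (SemidirectProduct.inr : ZH →* Ext i).range := hle ⟨_, rfl⟩
  have h1 := hHat_left_eq_one_of_mem_conj_smul_range_inr i hi hmem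
  rw [slopeSection_apply, left_inl_mul_inr, hHat_bPow_iotaZ_one_pow] at h1
  have hy : (m : ZMod i) = 0 := congrArg Heis.y h1
  rw [ZMod.natCast_eq_zero_iff] at hy
  exact absurd (Nat.eq_zero_of_dvd_of_lt hy hmi) (Nat.pos_iff_ne_zero.mp hm)

/-- **No conjugate of `T_m` (`0 < m < i`) lies in a conjugate of `I_v = 1 ⋊ Ẑ`.**
[cite: MochizukiAbsTopII2013, Prop 1.3 (x) p.12] -/
theorem not_conj_smul_range_slopeSection_le (hi : 0 < i) {m : ℕ} (hm : 0 < m) (hmi : m < i) (δ γ : Ext i) :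
    ¬ MulAut.conj δ • (slopeSection i m).range ≤ MulAut.conj γ • (SemidirectProduct.inr : ZH →* Ext i).range := by
  rw [Subgroup.pointwise_smul_subset_iff, smul_smul, ← map_inv, ← map_mul]
  exact not_range_slopeSection_le_conj_smul_range_inr i hi hm hmi _

/-- **`δ T_m δ⁻¹ ≤ (δ.left,1) · I_e · (δ.left,1)⁻¹`** with `I_e = Z_{Π_I}(Π_e × 1) = b^Ẑ ⋊ Ẑ` (every `b`-power
centralises the node group, and so does the twist section). [cite: MochizukiAbsTopII2013, Prop 1.3 (x) p.12] -/
theorem conj_smul_range_slopeSection_le (m : ℕ) (δ : Ext i) :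
    MulAut.conj δ • (slopeSection i m).range ≤
      MulAut.conj (SemidirectProduct.inl δ.left : Ext i) •
        (Subgroup.centralizer ((nodeGp.map (SemidirectProduct.inl : F₂hatT →* Ext i) : Subgroup (Ext i)) :
          Set (Ext i)) ⊓ (⊤ : Subgroup (Ext i))) := by
  rw [← conj_smul_eq_conj_inl_left_smul i (range_inr_le_centralizer i) δ,
    Subgroup.pointwise_smul_le_pointwise_smul_iff]
  rintro _ ⟨k, rfl⟩
  rw [mem_centralizer_node_inf_top_iff, slopeSection_apply, left_inl_mul_inr]
  exact bPow_mem_centralizer_nodeGp _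

/-- **`δ U_n δ⁻¹ ≤ (δ.left,1) · D_c · (δ.left,1)⁻¹`** with `D_c = N_{Π_I}(Π_c × 1) = c^Ẑ ⋊ Ẑ` (abc-iut-f-069's
`normalizer_map_inl_cuspGp_eq`). [cite: MochizukiAbsTopII2013, Prop 1.3 (x) p.12] -/
theorem conj_smul_range_cuspSlopeSection_le (n : ℕ) (δ : Ext i) :
    MulAut.conj δ • (cuspSlopeSection i n).range ≤
      MulAut.conj (SemidirectProduct.inl δ.left : Ext i) •
        (cuspGp.map (SemidirectProduct.inl : F₂hatT →* Ext i) ⊔ (SemidirectProduct.inr : ZH →* Ext i).range) := by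
  rw [← conj_smul_eq_conj_inl_left_smul i le_sup_right δ, Subgroup.pointwise_smul_le_pointwise_smul_iff]
  rintro _ ⟨k, rfl⟩
  rw [mem_map_inl_sup_range_inr_iff (shearPow_mem_cuspGp_of_mem i), cuspSlopeSection_apply, left_inl_mul_inr,
    cuspGp_eq_cAxis]
  exact cPow_mem_cAxis _

/-! ### The members of the family `logPoints i hi` -/

section Members

variable {i} (hi : 0 < i)

/-- The smooth member `δ` has image `δ · (1 ⋊ Ẑ) · δ⁻¹ = δ I_v δ⁻¹`. [cite: MochizukiAbsTopII2013, Prop 1.3 (x) p.12] -/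
theorem logPoints_smooth_image_eq (δ : Ext i) :
    (logPoints i hi (LogPt.smooth δ)).image = MulAut.conj δ • (SemidirectProduct.inr : ZH →* Ext i).range := by
  rw [logPoints_smooth_image, range_slopeSection_zero]

/-- The smooth member is verticial (its image IS a conjugate of `I_v`). [cite: MochizukiAbsTopII2013, Prop 1.3 (x) p.12] -/
theorem not_isNonVerticial_logPoints_smooth (δ : Ext i) :
    ¬ (logPoints i hi (LogPt.smooth δ)).IsNonVerticial := fun h =>
  h ⟨()⟩ δ (by
    rw [Iv_dpsc_eq_range_inr_holds]
    exact (logPoints_smooth_image_eq hi δ).le)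

/-- **The smooth member's image is a `Π_𝔾`-conjugate of `I_v`** (`δ I_v δ⁻¹ = (δ.left,1) I_v (δ.left,1)⁻¹`).
[cite: MochizukiAbsTopII2013, Prop 1.3 (x) p.12] -/
theorem exists_image_eq_conj_Iv_logPoints_smooth (δ : Ext i) (v : (dpsc i hi).Vert) :
    ∃ γ : (dpsc i hi).PiH, γ ∈ (dpsc i hi).PiG ∧
      (logPoints i hi (LogPt.smooth δ)).image = MulAut.conj γ • (dpsc i hi).Iv v := by
  refine ⟨SemidirectProduct.inl δ.left, ⟨δ.left, rfl⟩, ?_⟩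
  rw [Iv_dpsc_eq_range_inr_holds]
  exact (logPoints_smooth_image_eq hi δ).trans (conj_smul_eq_conj_inl_left_smul i le_rfl δ)

/-- **The node member `(δ, m)`, `0 < m < i`, is NON-VERTICIAL.** [cite: MochizukiAbsTopII2013, Prop 1.3 (x) p.12] -/
theorem isNonVerticial_logPoints_node (δ : Ext i) (m : ℕ) (hm : 0 < m) (hmi : m < i) :
    (logPoints i hi (LogPt.node δ m hm hmi)).IsNonVerticial := by
  intro v g
  rw [logPoints_node_image, Iv_dpsc_eq_range_inr_holds]
  exact not_conj_smul_range_slopeSection_le i hi hm hmi δ g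

/-- The node member's image is no `Π_𝔾`-conjugate of `I_v` (it is not even contained in one).
[cite: MochizukiAbsTopII2013, Prop 1.3 (x) p.12] -/
theorem not_exists_image_eq_conj_Iv_logPoints_node (δ : Ext i) (m : ℕ) (hm : 0 < m) (hmi : m < i)
    (v : (dpsc i hi).Vert) :
    ¬ ∃ γ : (dpsc i hi).PiH, γ ∈ (dpsc i hi).PiG ∧
      (logPoints i hi (LogPt.node δ m hm hmi)).image = MulAut.conj γ • (dpsc i hi).Iv v := by
  rintro ⟨γ, -, hγ⟩
  exact isNonVerticial_logPoints_node hi δ m hm hmi v γ hγ.le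

/-- **The node member lies in a `Π_𝔾`-conjugate of `I_e`**: `δ T_m δ⁻¹ ≤ (δ.left,1) I_e (δ.left,1)⁻¹`.
[cite: MochizukiAbsTopII2013, Prop 1.3 (x) p.12] -/
theorem exists_image_le_conj_IvNode_logPoints_node (δ : Ext i) (m : ℕ) (hm : 0 < m) (hmi : m < i)
    (e : (dpsc i hi).Node) :
    ∃ γ : (dpsc i hi).PiH, γ ∈ (dpsc i hi).PiG ∧
      (logPoints i hi (LogPt.node δ m hm hmi)).image ≤ MulAut.conj γ • (dpsc i hi).IvNode e := by
  refine ⟨SemidirectProduct.inl δ.left, ⟨δ.left, rfl⟩, ?_⟩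
  rw [logPoints_node_image, dpsc_IvNode]
  exact conj_smul_range_slopeSection_le i m δ

/-- The node member is edge-like (it lies in a conjugate of `I_e`). [cite: MochizukiAbsTopII2013, Prop 1.3 (x) p.12] -/
theorem not_isNonEdgeLike_logPoints_node (δ : Ext i) (m : ℕ) (hm : 0 < m) (hmi : m < i) :
    ¬ (logPoints i hi (LogPt.node δ m hm hmi)).IsNonEdgeLike := fun h => by
  obtain ⟨γ, -, hγ⟩ := exists_image_le_conj_IvNode_logPoints_node hi δ m hm hmi ⟨()⟩
  exact h (Sum.inl ⟨()⟩) γ hγ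

/-- **The cusp member lies in a `Π_𝔾`-conjugate of `D_c`**: `δ U_n δ⁻¹ ≤ (δ.left,1) D_c (δ.left,1)⁻¹`.
[cite: MochizukiAbsTopII2013, Prop 1.3 (x) p.12] -/
theorem exists_image_le_conj_DvCusp_logPoints_cusp (δ : Ext i) (n : ℕ) (hn : 0 < n) (c : (dpsc i hi).Cusp) :
    ∃ γ : (dpsc i hi).PiH, γ ∈ (dpsc i hi).PiG ∧
      (logPoints i hi (LogPt.cusp δ n hn)).image ≤ MulAut.conj γ • (dpsc i hi).DvCusp c := by
  refine ⟨SemidirectProduct.inl δ.left, ⟨δ.left, rfl⟩, ?_⟩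
  rw [logPoints_cusp_image, dpsc_DvCusp, normalizer_map_inl_cuspGp_eq]
  exact conj_smul_range_cuspSlopeSection_le i n δ

/-! ### Prop 1.3 (x) member by member -/

/-- **Prop 1.3 (x) at a SMOOTH point** of the component: clause 1 is idle (the section IS verticial); "`τ_I(I) =
I_{v_τ}` [`Π_𝔾`-conjugate] ⇔ image a smooth point of `v_τ`" holds with both sides TRUE; the node clause with both
sides FALSE. [cite: MochizukiAbsTopII2013, Prop 1.3 (x) p.12] -/
theorem prop13x_logPoints_smooth (δ : Ext i) : (logPoints i hi (LogPt.smooth δ)).Prop13x := by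
  refine ⟨fun hnv _ => absurd hnv (not_isNonVerticial_logPoints_smooth hi δ),
    fun _ => ⟨fun v => ?_, fun e => ?_⟩⟩
  · obtain ⟨⟨⟩⟩ := v
    exact ⟨fun _ => rfl, fun _ => exists_image_eq_conj_Iv_logPoints_smooth hi δ ⟨()⟩⟩
  · constructor
    · rintro ⟨hnv, -⟩
      exact absurd hnv (not_isNonVerticial_logPoints_smooth hi δ)
    · intro h
      rw [logPoints_smooth_kind] at h
      exact absurd h (by simp)

/-- **Prop 1.3 (x) at a log point of THE NODE** (`0 < m < i`): clause 1 idle (the section IS edge-like); "`τ_I(I) =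
I_{v_τ}`" FALSE on both sides (non-verticial; labelled node); the NODE clause "`τ_I` non-verticial and
`τ_I(I) ⊆ I_{e_τ}` ⇔ the image is the node `e_τ`" holds with both sides TRUE — it FIRES.
[cite: MochizukiAbsTopII2013, Prop 1.3 (x) p.12] -/
theorem prop13x_logPoints_node (δ : Ext i) (m : ℕ) (hm : 0 < m) (hmi : m < i) :
    (logPoints i hi (LogPt.node δ m hm hmi)).Prop13x := by
  refine ⟨fun _ hne => absurd hne (not_isNonEdgeLike_logPoints_node hi δ m hm hmi),
    fun _ => ⟨fun v => ?_, fun e => ?_⟩⟩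
  · constructor
    · intro h
      exact absurd h (not_exists_image_eq_conj_Iv_logPoints_node hi δ m hm hmi v)
    · intro h
      rw [logPoints_node_kind] at h
      exact absurd h (by simp)
  · obtain ⟨⟨⟩⟩ := e
    exact ⟨fun _ => rfl, fun _ => ⟨isNonVerticial_logPoints_node hi δ m hm hmi,
      exists_image_le_conj_IvNode_logPoints_node hi δ m hm hmi ⟨()⟩⟩⟩

/-- **Prop 1.3 (x) at a log point of THE CUSP** (`n ≥ 1`): clause 2 idle (the image point IS a cusp); clause 1's
conclusion "the image is the unique cusp `e_τ` with `τ_I(I) ⊆ D_{e_τ}` [`Π_𝔾`-conjugate]" holds (one cusp;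
`U_n ≤ D_c`). [cite: MochizukiAbsTopII2013, Prop 1.3 (x) p.12] -/
theorem prop13x_logPoints_cusp (δ : Ext i) (n : ℕ) (hn : 0 < n) : (logPoints i hi (LogPt.cusp δ n hn)).Prop13x := by
  refine ⟨fun _ _ => ⟨⟨()⟩, rfl, fun e' => ?_⟩, fun h => absurd (logPoints_cusp_kind hi δ n hn) (h ⟨()⟩)⟩
  obtain ⟨⟨⟩⟩ := e'
  exact ⟨fun _ => rfl, fun _ => exists_image_le_conj_DvCusp_logPoints_cusp hi δ n hn ⟨()⟩⟩

/-! ### The closers -/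

/-- **[AbsTopII] Prop 1.3 (x) — statement of record `DPSCIndexData.Prop_1_3_x''` — HOLDS at the nodal Dehn-twist
datum `dpsc i hi` for the family `logPoints i hi` of its log points, with NO hypothesis.**
[cite: MochizukiAbsTopII2013, Prop 1.3 (x) p.12] -/
theorem prop_1_3_x''_dpsc_holds : (dpsc i hi).Prop_1_3_x'' (logPoints i hi) := by
  intro l
  cases l with
  | smooth δ => exact prop13x_logPoints_smooth hi δ
  | node δ m hm hmi => exact prop13x_logPoints_node hi δ m hm hmi
  | cusp δ n hn => exact prop13x_logPoints_cusp hi δ n hn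

/-- **The NODE clause of Prop 1.3 (x) FIRES at the nodal datum** (`i ≥ 2`): the member `(δ, 1)` is labelled by
the node, is non-verticial, and its section lies in a `Π_𝔾`-conjugate of `I_e` — both sides of "`τ_I` non-verticial
and `τ_I(I) ⊆ I_{e_τ}` ⇔ the image of `τ_S` is the node `e_τ`" are TRUE. [cite: MochizukiAbsTopII2013, Prop 1.3 (x) p.12] -/
theorem node_clause_fires (h1i : 1 < i) (δ : Ext i) (e : (dpsc i hi).Node) :
    (logPoints i hi (LogPt.node δ 1 Nat.one_pos h1i)).kind = DPSCIndexData.PointKind.node e ∧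
      (logPoints i hi (LogPt.node δ 1 Nat.one_pos h1i)).IsNonVerticial ∧
      ∃ γ : (dpsc i hi).PiH, γ ∈ (dpsc i hi).PiG ∧
        (logPoints i hi (LogPt.node δ 1 Nat.one_pos h1i)).image ≤ MulAut.conj γ • (dpsc i hi).IvNode e := by
  obtain ⟨⟨⟩⟩ := e
  exact ⟨rfl, isNonVerticial_logPoints_node hi δ 1 Nat.one_pos h1i,
    exists_image_le_conj_IvNode_logPoints_node hi δ 1 Nat.one_pos h1i ⟨()⟩⟩

end Members

/-- **Existence form for the census: a DPSC datum WITH A NODE at which Prop 1.3 (x) (`Prop_1_3_x''`) HOLDS for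
an honest family of log points realising every kind, NON-IDLY in the node clause** — for every speed `i ≥ 2`:
smooth / node / cusp members all occur, every node has a member that is non-verticial with section inside a
`Π_𝔾`-conjugate of `I_e`, and the family satisfies the printed clauses.  No hypothesis.
[cite: MochizukiAbsTopII2013, Prop 1.3 (x) p.12] -/
theorem exists_nodal_model_prop_1_3_x'' (i : ℕ) (hi2 : 2 ≤ i) :
    ∃ (X : DPSCIndexData.{0}) (L : Type) (pt : L → X.LogPointData),
      Nonempty X.Node ∧ X.Prop_1_3_x'' pt ∧
      (∀ v : X.Vert, ∃ l, (pt l).kind = DPSCIndexData.PointKind.smooth v) ∧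
      (∀ c : X.Cusp, ∃ l, (pt l).kind = DPSCIndexData.PointKind.cusp c) ∧
      (∀ e : X.Node, ∃ l, (pt l).kind = DPSCIndexData.PointKind.node e ∧ (pt l).IsNonVerticial ∧
        ∃ γ : X.PiH, γ ∈ X.PiG ∧ (pt l).image ≤ MulAut.conj γ • X.IvNode e) := by
  have hi : 0 < i := by omega
  refine ⟨dpsc i hi, LogPt i, logPoints i hi, dpsc_node_nonempty i hi, prop_1_3_x''_dpsc_holds hi,
    fun v => ?_, fun c => ?_, fun e => ?_⟩
  · obtain ⟨⟨⟩⟩ := v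
    exact ⟨LogPt.smooth 1, rfl⟩
  · obtain ⟨⟨⟩⟩ := c
    exact ⟨LogPt.cusp 1 1 Nat.one_pos, rfl⟩
  · exact ⟨LogPt.node 1 1 Nat.one_pos (by omega), node_clause_fires hi (by omega) 1 e⟩

end Literature.AnabelianGeometry.AbsoluteAnabelian.AbsTopII.DehnTwist

end
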